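import Mathlib
import Summits.Ventures.PercRepro2.Defs
import Summits.Ventures.PercRepro2.Graph
import Summits.Ventures.PercRepro2.OneColourSwitch
import Summits.Ventures.PercRepro2.RegionHubSign
import Summits.Ventures.PercRepro2.SideSwitch
import Summits.Ventures.PercRepro2.SideSwitchClosed
import Summits.Ventures.PercRepro2.SideSwitchComps
import Summits.Ventures.PercRepro2.SideSwitchFibre
import Summits.Ventures.PercRepro2.TermSwitchDefs
import Summits.Ventures.PercRepro2.TermSwitchFibre
import Summits.Ventures.PercRepro2.TermSwitchCompsFibre
import Summits.Ventures.PercRepro2.TermSwitchMono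
import Summits.Ventures.PercRepro2.TermSwitchReach

import Summits.Ventures.PercRepro2.M9OneSidedFibre

/-!
# The switched side of the one-sided characterisation (blind cell PercRepro2, p3 g30,
2026-08-28; `proofs/P3-HDR.md` §10(c))

Continuation of `M9OneSidedFibre`: `d ∈ M₂(ρ_T)` iff a SWITCHED block joins `d` to `{r, s}`
(`mem_M2_assignC_iff_joins`) — the `W`-cluster of `d` after the switch consists of `d`, the
outside vertices, the `W`-parts of the unswitched blocks (dead ends) and the switched blocks
entered by `d`'s flipped `Y`-edges; it reaches `r` or `s` only through a switched block whose old
`Y`-path joined `d` to the terminal.  Own work; std axioms.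
-/

namespace Summit.Ventures.PercRepro2

namespace TermSwitch

open Finset Classical RegionHub OneColourSwitch SideSwitch

variable {V : Type*} {E : Type*}

section ClaimsM

variable [Fintype V] [DecidableEq V] {ends : E → Sym2 V} {p q r s d : V}

/-- **`d ∈ M₂` after the switch iff a switched block joins `d` to `{r, s}`.** -/
theorem mem_M2_assignC_iff_joins (hT : TFree ends r s d) {ρ : Config E}
    (hρ : ∀ x ∈ MH ends ({r, s, d} : Set V) ρ, x ∈ ({r, s, d} : Set V))
    {T : Finset (Finset V)} (hTc : T ⊆ compsH ends ({r, s, d} : Set V) ρ) :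
    d ∈ M2 ends r s (assignC ends T ρ) ↔
      ∃ B ∈ T, joinsB ends r s d B ρ := by
  have hd : d ∈ ({r, s, d} : Set V) := d_mem_triple r s d
  have hr : r ∈ ({r, s, d} : Set V) := r_mem_triple r s d
  have hs : s ∈ ({r, s, d} : Set V) := s_mem_triple r s d
  -- the `W`-colour of the switched colouring on an edge
  have hW : ∀ {e : E}, OneColourSwitch.compl (assignC ends T ρ) e = true ↔ assignC ends T ρ e = false := by
    intro e
    simp [OneColourSwitch.compl]
  constructor
  · intro hM
    by_contra hno
    simp only [not_exists, not_and] at hno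
    let Z : Set V := {x | x = d ∨ x ∉ KH ends ({r, s, d} : Set V) ρ ∪ MH ends ({r, s, d} : Set V) ρ ∨
      (∃ B ∈ compsH ends ({r, s, d} : Set V) ρ, B ∉ T ∧ x ∈ B) ∨
      (∃ B ∈ T, x ∈ B ∧ Conn ends (inB ends r s d B ρ) d x)}
    have key : ∀ v, v ∈ Z → ∀ y, (openGraph ends (OneColourSwitch.compl (assignC ends T ρ))).Adj v y →
        y ∈ Z := by
      intro v hv y hvy
      obtain ⟨hne, e, he, hends⟩ := openGraph_adj.1 hvy
      rw [hW] at he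
      -- the target `y`: a terminal, an outside vertex, or a sided vertex of a block
      by_cases hyH : y ∈ ({r, s, d} : Set V)
      · -- `y` is a terminal: it must be `d`
        by_cases hyd : y = d
        · exact Or.inl hyd
        have hyrs : y = r ∨ y = s := by
          simp only [Set.mem_insert_iff, Set.mem_singleton_iff] at hyH
          rcases hyH with h | h | h
          · exact Or.inl h
          · exact Or.inr h
          · exact absurd h hyd
        have hyK : y ∈ KH ends ({r, s, d} : Set V) ρ := mem_KH_iff.2 ⟨y, hyH, conn_refl _ _ _⟩
        rcases hv with hvd | hvO | ⟨B, hB, hBT, hvB⟩ | ⟨B, hBT, hvB, hvc⟩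
        · rw [hvd] at hends hne
          exact (no_terminal_edge hT hends hne hd hyH).elim
        · -- an outside vertex `W`-adjacent to `r` or `s` would lie in `MH`
          exfalso
          have hvU : v ∉ unionT T := out_notMem_unionT hTc hvO
          have hyU : y ∉ unionT T := term_notMem_unionT hTc hyH
          rw [assignC_eq_of_notMem hends hvU hyU] at he
          apply hvO
          exact Or.inr (mem_MH_iff.2 ⟨y, hyH, conn_of_openAdj ⟨e, by simp [OneColourSwitch.compl, he],
            by rw [hends, Sym2.eq_swap]⟩⟩)
        · -- an edge from an unswitched block to a terminal is `Y`
          exfalso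
          have hvU : v ∉ unionT T := notMem_unionT_of_mem_of_notMem hTc hB hBT hvB
          have hyU : y ∉ unionT T := term_notMem_unionT hTc hyH
          rw [assignC_eq_of_notMem hends hvU hyU] at he
          have hvH : v ∉ ({r, s, d} : Set V) := fun h => term_notMem_A0H h (subset_A0H_of_mem_compsH hB hvB)
          have := edge_term_sided_true hρ (by rw [hends, Sym2.eq_swap]) hyH hvH
          rw [he] at this
          exact absurd this (by decide)
        · -- a switched block joined to a terminal: it joins `d` to `r` or `s`
          exfalso
          have hvU : v ∈ unionT T := mem_unionT.2 ⟨B, hBT, hvB⟩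
          rw [assignC_eq_not_of_mem hends (Or.inl hvU)] at he
          have hρe : ρ e = true := by
            rcases h : ρ e with _ | _
            · rw [h] at he; exact absurd he (by decide)
            · rfl
          have hc : Conn ends (inB ends r s d B ρ) d y := conn_trans hvc (conn_of_openAdj ⟨e,
            inB_eq_true_iff.2 ⟨⟨v, Or.inl (Finset.mem_coe.2 hvB), y, Or.inr hyH, hends⟩, hρe⟩, hends⟩)
          rcases hyrs with rfl | rfl
          · exact hno B hBT (Or.inl hc)
          · exact hno B hBT (Or.inr hc)
      by_cases hyS : y ∈ KH ends ({r, s, d} : Set V) ρ ∪ MH ends ({r, s, d} : Set V) ρ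
      · -- `y` is sided: it lies in a block `B`
        have hyA : y ∈ A0H ends ({r, s, d} : Set V) ρ := mem_A0H.2 ⟨hyS, hyH⟩
        obtain ⟨B, hB, hyB⟩ := exists_block_of_mem_A0H hyA
        have hyK : y ∈ KH ends ({r, s, d} : Set V) ρ := mem_KH_of_mem_A0H hρ hyA
        by_cases hBT : B ∈ T
        · -- a switched block: `y` is joined to `d` inside `B` by the old `Y`-edge
          have hyU : y ∈ unionT T := mem_unionT.2 ⟨B, hBT, hyB⟩
          rw [assignC_eq_not_of_mem hends (Or.inr hyU)] at he
          have hρe : ρ e = true := by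
            rcases h : ρ e with _ | _
            · rw [h] at he; exact absurd he (by decide)
            · rfl
          rcases hv with hvd | hvO | ⟨B', hB', hB'T, hvB'⟩ | ⟨B', hB'T, hvB', hvc⟩
          · rw [hvd] at hends
            exact Or.inr (Or.inr (Or.inr ⟨B, hBT, hyB, conn_of_openAdj ⟨e,
              inB_eq_true_iff.2 ⟨⟨d, Or.inr hd, y, Or.inl (Finset.mem_coe.2 hyB), hends⟩, hρe⟩, hends⟩⟩))
          · -- a `Y`-edge from an outside vertex to the `Y`-world: impossible
            exfalso
            have := edge_KH_out_false (by rw [hends, Sym2.eq_swap]) hyK (fun h => hvO (Or.inl h))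
            rw [hρe] at this; exact absurd this (by decide)
          · -- two different blocks are never adjacent
            exfalso
            have hyB' : y ∈ B' := mem_of_adj_of_mem_compsH hB' hends hvB' hyA
            rw [eq_of_mem_compsH_of_mem hB' hB hyB' hyB] at hB'T
            exact hB'T hBT
          · have hvA : v ∈ A0H ends ({r, s, d} : Set V) ρ := subset_A0H_of_mem_compsH (hTc hB'T) hvB'
            have hyB' : y ∈ B' := mem_of_adj_of_mem_compsH (hTc hB'T) hends hvB' hyA
            have hBB : B' = B := eq_of_mem_compsH_of_mem (hTc hB'T) hB hyB' hyB
            subst hBB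
            exact Or.inr (Or.inr (Or.inr ⟨B', hB'T, hyB, conn_trans hvc (conn_of_openAdj ⟨e,
              inB_eq_true_iff.2 ⟨⟨v, Or.inl (Finset.mem_coe.2 hvB'), y, Or.inl (Finset.mem_coe.2 hyB), hends⟩,
                hρe⟩, hends⟩)⟩))
        · exact Or.inr (Or.inr (Or.inl ⟨B, hB, hBT, hyB⟩))
      · -- `y` is outside both worlds
        exact Or.inr (Or.inl hyS)
    have hrZ : r ∉ Z := by
      rintro (h | h | ⟨B, hB, _, hrB⟩ | ⟨B, hBT, hrB, _⟩)
      · exact hT.rd h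
      · exact h (Or.inl (mem_KH_iff.2 ⟨r, hr, conn_refl _ _ _⟩))
      · exact term_notMem_A0H hr (subset_A0H_of_mem_compsH hB hrB)
      · exact term_notMem_A0H hr (subset_A0H_of_mem_compsH (hTc hBT) hrB)
    have hsZ : s ∉ Z := by
      rintro (h | h | ⟨B, hB, _, hsB⟩ | ⟨B, hBT, hsB, _⟩)
      · exact hT.sd h
      · exact h (Or.inl (mem_KH_iff.2 ⟨s, hs, conn_refl _ _ _⟩))
      · exact term_notMem_A0H hs (subset_A0H_of_mem_compsH hB hsB)
      · exact term_notMem_A0H hs (subset_A0H_of_mem_compsH (hTc hBT) hsB)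
    rcases mem_M2_iff.1 hM with hc | hc
    · exact hrZ (mem_of_conn_of_closed key (Or.inl rfl) (conn_symm hc))
    · exact hsZ (mem_of_conn_of_closed key (Or.inl rfl) (conn_symm hc))
  · rintro ⟨B, hBT, hj⟩
    -- the joining `Y`-path of a switched block is a `W`-path after the switch
    have htr : ∀ {a b : V}, Conn ends (inB ends r s d B ρ) a b →
        Conn ends (OneColourSwitch.compl (assignC ends T ρ)) a b := by
      intro a b hab
      have key : ∀ v, v ∈ {x | Conn ends (OneColourSwitch.compl (assignC ends T ρ)) a x} → ∀ y,
          (openGraph ends (inB ends r s d B ρ)).Adj v y →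
            y ∈ {x | Conn ends (OneColourSwitch.compl (assignC ends T ρ)) a x} := by
        intro v hv y hvy
        obtain ⟨hne, e, he, hends⟩ := openGraph_adj.1 hvy
        obtain ⟨⟨c, hc, c', hc', hcc'⟩, hρe⟩ := inB_eq_true_iff.1 he
        -- one end of the edge lies in `B ⊆ unionT T`
        have hU : v ∈ unionT T ∨ y ∈ unionT T := by
          rw [hends] at hcc'
          have hmem : ∀ z, z ∈ (↑B : Set V) → z ∈ unionT T :=
            fun z hz => mem_unionT.2 ⟨B, hBT, Finset.mem_coe.1 hz⟩
          rcases Sym2.eq_iff.1 hcc' with ⟨hvc, hyc'⟩ | ⟨hvc', hyc⟩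
          · rcases hc with hc | hc
            · exact Or.inl (hvc ▸ hmem c hc)
            · rcases hc' with hc' | hc'
              · exact Or.inr (hyc' ▸ hmem c' hc')
              · exact (no_terminal_edge hT hends hne (hvc ▸ hc) (hyc' ▸ hc')).elim
          · rcases hc' with hc' | hc'
            · exact Or.inl (hvc' ▸ hmem c' hc')
            · rcases hc with hc | hc
              · exact Or.inr (hyc ▸ hmem c hc)
              · exact (no_terminal_edge hT hends hne (hvc' ▸ hc') (hyc ▸ hc)).elim
        have he' : OneColourSwitch.compl (assignC ends T ρ) e = true := by
          rw [hW, assignC_eq_not_of_mem hends hU, hρe]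
          rfl
        exact conn_trans hv (conn_of_openAdj ⟨e, he', hends⟩)
      exact mem_of_conn_of_closed key (conn_refl _ _ _) hab
    rcases hj with hj | hj
    · exact mem_M2_iff.2 (Or.inl (conn_symm (htr hj)))
    · exact mem_M2_iff.2 (Or.inr (conn_symm (htr hj)))

end ClaimsM

end TermSwitch

end Summit.Ventures.PercRepro2
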